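import Literature.Probability.Process.ConformalTimeChange
import Literature.Probability.Process.ContinuousOptionalSampling
import HarnessLib

/-!
# The conformal exponential martingale sampled along the inverse clock

Fourth file on P. Lévy's conformal invariance of planar Brownian motion (Lawler (2005),
Thm. 2.2; Le Gall (2016), Thm. 5.13 (Dambis–Dubins–Schwarz) and Thm. 7.19). With the stopped
position `X^ρ` and conformal clock `σ` of `ConformalMartingaleClock` and the inverse clock
`α_u = clockInv u` of `ConformalTimeChange`:

* `confExp θ` — the process `E^θ_t = exp(i Re(θ̄ f(X_{t∧ρ})) + |θ|² σ_{t∧ρ}/2)`; continuous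
  paths, adapted, `‖E^θ_t‖ = exp(|θ|² σ_t/2)`;
* `martingale_re_confExp`, `martingale_im_confExp` — its real and imaginary parts are
  martingales of the natural filtration (the exponential martingale identity
  `integral_mul_cexp_conformal_eq`, characterisation of the conditional expectation by set
  integrals);
* `integral_mul_confExp_clockInv_eq` — **optional sampling along the time change**: for
  `u ≤ v` and a bounded complex `𝓕_{α_u}`-measurable weight `G`,
  `E[G · E^θ_{α_v}] = E[G · E^θ_{α_u}]` (`ContinuousOptionalSampling`; the stopped processes are
  bounded by `exp(|θ|² v/2)` because `σ_{α_v} = v ∧ S`, and `α_v ≤ ρ < ∞` a.s.).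

In the next file this identity, iterated over ordered times, yields the joint characteristic
function of the increments of the time-changed process `f(X_{α_u})`.

## References

* G. F. Lawler, *Conformally Invariant Processes in the Plane*, AMS (2005), Thm. 2.2.
* J.-F. Le Gall, *Brownian Motion, Martingales, and Stochastic Calculus* (2016), Thm. 5.12,
  Thm. 5.13, Thm. 7.19.
-/

noncomputable section

open MeasureTheory Filter Topology Set Complex
open scoped NNReal ENNReal BigOperators ComplexConjugate

namespace Literature.Probability.Process

variable {Ω : Type*} {mΩ : MeasurableSpace Ω} {P : Measure Ω} {W : ℝ≥0 → Ω → (Fin 2 → ℝ)}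

namespace IsBrownianVec

variable {x₀ : Fin 2 → ℝ} {U : Set (Fin 2 → ℝ)} {D : Set ℂ} {f : ℂ → ℂ}

/-! ### The exponential process -/

/-- The norm of the exponential process: `‖E^θ_t‖ = exp(|θ|² σ_t / 2)`. [folklore] -/
theorem norm_confExp (θ : ℂ) (t : ℝ≥0) (ω : Ω) :
    ‖confExp θ x₀ W f U t ω‖ = Real.exp (‖θ‖ ^ 2 * confClock x₀ W f U t ω / 2) := by
  rw [confExp, Complex.norm_exp]
  congr 1
  rw [Complex.add_re, Complex.mul_re, Complex.I_re, Complex.I_im, Complex.ofReal_re, Complex.ofReal_im,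
    Complex.ofReal_re]
  ring

/-- `Re(θ̄ f)` of the stopped position is `𝓕_t`-measurable (it only sees `closure U`, where the
function is continuous). [folklore] -/
theorem measurable_rePart_confPos (hW : IsBrownianVec W P) (hD : IsOpen D) (hf : DifferentiableOn ℂ f D)
    (hU : IsOpen U) (hUD : closure U ⊆ toC ⁻¹' D) (hx₀ : x₀ ∈ U) (θ : ℂ) {r t : ℝ≥0} (hrt : r ≤ t) :
    Measurable[hW.natFiltration t] fun ω ↦ rePart θ f (confPos x₀ W U r ω) := by
  have hV : ContinuousOn (rePart θ f) (closure U) := ((contDiffOn_rePart hD hf θ (n := 0)).continuousOn).mono hUD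
  have hc : Continuous ((closure U).restrict (rePart θ f)) := hV.restrict
  have hm : Measurable[hW.natFiltration t] fun ω ↦ (⟨confPos x₀ W U r ω, hW.confPos_mem_closure hU hx₀ r ω⟩ : closure U) :=
    (hW.measurable_confPos_le hU hrt).subtype_mk
  exact hc.measurable.comp hm

/-- The exponential process is adapted. [folklore] -/
theorem stronglyMeasurable_confExp (hW : IsBrownianVec W P) (hD : IsOpen D) (hf : DifferentiableOn ℂ f D)
    (hU : IsOpen U) (hUD : closure U ⊆ toC ⁻¹' D) (hx₀ : x₀ ∈ U) (θ : ℂ) {r t : ℝ≥0} (hrt : r ≤ t) :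
    StronglyMeasurable[hW.natFiltration t] (confExp θ x₀ W f U r) := by
  refine Measurable.stronglyMeasurable ?_
  unfold confExp
  have h1 := hW.measurable_rePart_confPos hD hf hU hUD hx₀ θ hrt
  have h2 : Measurable[hW.natFiltration t] (confClock x₀ W f U r) :=
    ((hW.stronglyAdapted_confClock hD hf hU hUD hx₀ r).measurable).mono (hW.natFiltration.mono hrt) le_rfl
  exact Complex.measurable_exp.comp ((measurable_const.mul (Complex.measurable_ofReal.comp h1)).add
    (Complex.measurable_ofReal.comp ((h2.const_mul _).div_const _)))

/-- The exponential process has continuous paths. [folklore] -/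
theorem continuous_confExp (hW : IsBrownianVec W P) (hD : IsOpen D) (hf : DifferentiableOn ℂ f D)
    (hU : IsOpen U) (hUD : closure U ⊆ toC ⁻¹' D) (hx₀ : x₀ ∈ U) (θ : ℂ) (ω : Ω) :
    Continuous fun t ↦ confExp θ x₀ W f U t ω := by
  have hV : ContinuousOn (rePart θ f) (closure U) := ((contDiffOn_rePart hD hf θ (n := 0)).continuousOn).mono hUD
  have h1 : Continuous fun t ↦ rePart θ f (confPos x₀ W U t ω) :=
    hV.comp_continuous (hW.continuous_confPos ω) fun t ↦ hW.confPos_mem_closure hU hx₀ t ω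
  have h2 := hW.continuous_confClock hD hf hU hUD hx₀ ω
  unfold confExp
  fun_prop

/-- A bound for the exponential process up to time `t`: `‖E^θ_r‖ ≤ exp(|θ|² M t / 2)` for
`r ≤ t`, `M ≥ |f'|²` on `closure U`. [folklore] -/
theorem norm_confExp_le (hW : IsBrownianVec W P) (hD : IsOpen D) (hf : DifferentiableOn ℂ f D)
    (hU : IsOpen U) (hUD : closure U ⊆ toC ⁻¹' D) (hx₀ : x₀ ∈ U) (θ : ℂ) {M : ℝ}
    (hM : ∀ y ∈ closure U, ‖deriv f (toC y)‖ ^ 2 ≤ M) (hM0 : 0 ≤ M) {r t : ℝ≥0} (hrt : r ≤ t) (ω : Ω) :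
    ‖confExp θ x₀ W f U r ω‖ ≤ Real.exp (‖θ‖ ^ 2 * (M * t) / 2) := by
  rw [norm_confExp]
  gcongr
  -- `σ_r ≤ M r ≤ M t`
  have h := hW.confClock_sub hD hf hU hUD hx₀ ω 0 r
  rw [confClock_zero, sub_zero, stopT_zero, NNReal.coe_zero] at h
  have hbd : ‖∫ x in (0 : ℝ)..(stopT x₀ W U r ω : ℝ), ‖deriv f (toC (confPos x₀ W U x.toNNReal ω))‖ ^ 2‖ ≤
      M * |(stopT x₀ W U r ω : ℝ) - 0| :=
    intervalIntegral.norm_integral_le_of_norm_le_const fun x _ ↦ by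
      rw [Real.norm_eq_abs, abs_of_nonneg (by positivity)]
      exact hM _ (hW.confPos_mem_closure hU hx₀ _ ω)
  rw [sub_zero, abs_of_nonneg (stopT x₀ W U r ω).coe_nonneg, ← h] at hbd
  have hσ0 : 0 ≤ confClock x₀ W f U r ω := by
    have := hW.confClock_mono hD hf hU hUD hx₀ ω (show (0 : ℝ≥0) ≤ r from bot_le); rwa [confClock_zero] at this
  rw [Real.norm_eq_abs, abs_of_nonneg hσ0] at hbd
  calc confClock x₀ W f U r ω ≤ M * (stopT x₀ W U r ω : ℝ) := hbd
    _ ≤ M * t := mul_le_mul_of_nonneg_left ((NNReal.coe_le_coe.2 (stopT_le r ω)).trans (NNReal.coe_le_coe.2 hrt)) hM0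

section Martingale

variable [IsProbabilityMeasure P]

/-- **The real and imaginary parts of the exponential process are martingales** (set integrals
over `𝓕_s`-measurable sets are constant in time, by the exponential martingale identity with the
weight `𝟙_A`). [cite: Legall2016, Thm. 5.12 (proof)] -/
theorem martingale_reIm_confExp (hW : IsBrownianVec W P) (hD : IsOpen D) (hf : DifferentiableOn ℂ f D)
    (hU : IsOpen U) (hUc : IsCompact (closure U)) (hUD : closure U ⊆ toC ⁻¹' D) (hx₀ : x₀ ∈ U) (θ : ℂ)
    {L : ℂ → ℝ} (hL : L = Complex.re ∨ L = Complex.im) :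
    Martingale (fun t ω ↦ L (confExp θ x₀ W f U t ω)) hW.natFiltration P := by
  obtain ⟨M, hM1, hM⟩ := exists_bound_deriv_sq hD hf hUc hUD
  have hM0 : 0 ≤ M := by linarith
  have hLc : Continuous L := by rcases hL with rfl | rfl <;> fun_prop
  have hLn : ∀ z, |L z| ≤ ‖z‖ := fun z ↦ by
    rcases hL with rfl | rfl
    · exact Complex.abs_re_le_norm z
    · exact Complex.abs_im_le_norm z
  have hadapt : StronglyAdapted hW.natFiltration fun t ω ↦ L (confExp θ x₀ W f U t ω) := fun t ↦
    (hLc.measurable.comp (hW.stronglyMeasurable_confExp hD hf hU hUD hx₀ θ le_rfl).measurable).stronglyMeasurable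
  have hint : ∀ t, Integrable (fun ω ↦ L (confExp θ x₀ W f U t ω)) P := fun t ↦
    integrable_of_abs_le ((hadapt t).measurable.mono (hW.natFiltration.le t) le_rfl)
      (fun ω ↦ (hLn _).trans (hW.norm_confExp_le hD hf hU hUD hx₀ θ hM hM0 le_rfl ω))
  refine ⟨hadapt, fun s t hst ↦ ?_⟩
  symm
  refine ae_eq_condExp_of_forall_setIntegral_eq (hW.natFiltration.le s) (hint t)
    (fun A _ _ ↦ (hint s).integrableOn) (fun A hA _ ↦ ?_) (hadapt s).aestronglyMeasurable
  have hAm : MeasurableSet A := hW.natFiltration.le s _ hA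
  -- the exponential martingale identity with the weight `𝟙_A`
  set G : Ω → ℂ := A.indicator fun _ ↦ (1 : ℂ) with hG
  have hGm : AEStronglyMeasurable[hW.natFiltration s] G P :=
    (stronglyMeasurable_const.indicator hA).aestronglyMeasurable
  have hG1 : ∀ᵐ ω ∂P, ‖G ω‖ ≤ 1 := ae_of_all _ fun ω ↦ by
    by_cases hω : ω ∈ A <;> simp [hG, hω]
  have key := hW.integral_mul_cexp_conformal_eq hD hf hU hUc hUD hx₀ θ hst hGm hG1
  -- `∫_A L(E_r) = L (∫ G E_r)`
  have hiE : ∀ r, Integrable (confExp θ x₀ W f U r) P := fun r ↦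
    ⟨((hW.stronglyMeasurable_confExp hD hf hU hUD hx₀ θ le_rfl).mono (hW.natFiltration.le r)).aestronglyMeasurable,
      HasFiniteIntegral.of_bounded (ae_of_all _ fun ω ↦ hW.norm_confExp_le hD hf hU hUD hx₀ θ hM hM0 le_rfl ω)⟩
  have e : ∀ r, ∫ ω in A, L (confExp θ x₀ W f U r ω) ∂P = L (∫ ω, G ω * confExp θ x₀ W f U r ω ∂P) := by
    intro r
    have h1 : (fun ω ↦ G ω * confExp θ x₀ W f U r ω) = A.indicator (confExp θ x₀ W f U r) := by
      funext ω; by_cases hω : ω ∈ A <;> simp [hG, hω]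
    rw [h1, integral_indicator hAm]
    rcases hL with rfl | rfl
    · have h2 := Complex.reCLM.integral_comp_comm (hiE r).integrableOn (μ := P.restrict A)
      simp only [Complex.reCLM_apply] at h2
      exact h2
    · have h2 := Complex.imCLM.integral_comp_comm (hiE r).integrableOn (μ := P.restrict A)
      simp only [Complex.imCLM_apply] at h2
      exact h2
  rw [e s, e t]
  exact congrArg L key.symm

/-- The real part of the exponential process is a martingale. [cite: Legall2016, Thm. 5.12 (proof)] -/
theorem martingale_re_confExp (hW : IsBrownianVec W P) (hD : IsOpen D) (hf : DifferentiableOn ℂ f D)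
    (hU : IsOpen U) (hUc : IsCompact (closure U)) (hUD : closure U ⊆ toC ⁻¹' D) (hx₀ : x₀ ∈ U) (θ : ℂ) :
    Martingale (fun t ω ↦ (confExp θ x₀ W f U t ω).re) hW.natFiltration P :=
  hW.martingale_reIm_confExp hD hf hU hUc hUD hx₀ θ (L := Complex.re) (Or.inl rfl)

/-- The imaginary part of the exponential process is a martingale. [cite: Legall2016, Thm. 5.12 (proof)] -/
theorem martingale_im_confExp (hW : IsBrownianVec W P) (hD : IsOpen D) (hf : DifferentiableOn ℂ f D)
    (hU : IsOpen U) (hUc : IsCompact (closure U)) (hUD : closure U ⊆ toC ⁻¹' D) (hx₀ : x₀ ∈ U) (θ : ℂ) :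
    Martingale (fun t ω ↦ (confExp θ x₀ W f U t ω).im) hW.natFiltration P :=
  hW.martingale_reIm_confExp hD hf hU hUc hUD hx₀ θ (L := Complex.im) (Or.inr rfl)

end Martingale

/-! ### Optional sampling along the inverse clock -/

section Sampling

variable [IsProbabilityMeasure P]

/-- The stopped exponential processes along the inverse clocks `α_u ≤ α_v` are a.s. bounded by
`exp(|θ|² v / 2)` at all times (`σ_{t ∧ α_v} ≤ σ_{α_v} = v ∧ S ≤ v` on `{ρ < ∞}`). [folklore] -/
theorem ae_norm_stoppedProcess_confExp_le (hW : IsBrownianVec W P) (hD : IsOpen D)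
    (hf : DifferentiableOn ℂ f D) (hU : IsOpen U) (hUb : Bornology.IsBounded U)
    (hUD : closure U ⊆ toC ⁻¹' D) (hx₀ : x₀ ∈ U) (θ : ℂ) {u v : ℝ≥0} (huv : u ≤ v) :
    ∀ᵐ ω ∂P, ∀ t : ℝ≥0,
      ‖stoppedProcess (confExp θ x₀ W f U) (clockInv x₀ W f U v) t ω‖ ≤ Real.exp (‖θ‖ ^ 2 * v / 2) ∧
      ‖stoppedProcess (confExp θ x₀ W f U) (clockInv x₀ W f U u) t ω‖ ≤ Real.exp (‖θ‖ ^ 2 * v / 2) := by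
  filter_upwards [hW.ae_hitTime_ne_top hU hUb hx₀] with ω hρ
  obtain ⟨T, hT⟩ := WithTop.ne_top_iff_exists.1 hρ
  have hρT : hitTime x₀ W Uᶜ ω = T := hT.symm
  -- the clock at a time `≤ α_w` is at most `w`
  have hclock : ∀ (w : ℝ≥0) (t : ℝ≥0), confClock x₀ W f U (min (t : WithTop ℝ≥0) (clockInv x₀ W f U w ω)).untopA ω ≤ w := by
    intro w t
    obtain ⟨a, ha⟩ := WithTop.ne_top_iff_exists.1 (clockInv_ne_top (f := f) hρT w)
    have hval := hW.confClock_clockInv hD hf hU hUD hx₀ hρT w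
    rw [← ha, untopA_coe] at hval
    rw [← ha, untopA_min_coe_coe]
    calc confClock x₀ W f U (min t a) ω ≤ confClock x₀ W f U a ω :=
          hW.confClock_mono hD hf hU hUD hx₀ ω (min_le_right _ _)
      _ = min (w : ℝ) (confClock x₀ W f U T ω) := hval
      _ ≤ w := min_le_left _ _
  intro t
  simp only [stoppedProcess, norm_confExp]
  constructor
  · gcongr
    exact hclock v t
  · gcongr
    exact (hclock u t).trans (NNReal.coe_le_coe.2 huv)

/-- **Optional sampling of the exponential martingale along the inverse clock**: for `u ≤ v` and
a bounded complex `𝓕_{α_u}`-measurable weight `G`, `E[G · E^θ_{α_v}] = E[G · E^θ_{α_u}]`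
([Le Gall] proof of Thm. 5.13: `E[exp(iξ(β_v − β_u)) | 𝓖_u] = exp(−ξ²(v−u)/2)` for
`β = M_{τ_·}`, here in the conformal setting and tested against weights). [cite: Legall2016, Thm. 5.13 (proof)] -/
theorem integral_mul_confExp_clockInv_eq (hW : IsBrownianVec W P) (hD : IsOpen D)
    (hf : DifferentiableOn ℂ f D) (hU : IsOpen U) (hUb : Bornology.IsBounded U)
    (hUD : closure U ⊆ toC ⁻¹' D) (hx₀ : x₀ ∈ U) (θ : ℂ) {u v : ℝ≥0} (huv : u ≤ v) {G : Ω → ℂ}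
    (hG : AEStronglyMeasurable[(hW.isStoppingTime_clockInv hD hf hU hUD hx₀ u).measurableSpace] G P)
    {C : ℝ} (hGC : ∀ᵐ ω ∂P, ‖G ω‖ ≤ C) :
    ∫ ω, G ω * stoppedValue (confExp θ x₀ W f U) (clockInv x₀ W f U v) ω ∂P =
      ∫ ω, G ω * stoppedValue (confExp θ x₀ W f U) (clockInv x₀ W f U u) ω ∂P := by
  have hUc : IsCompact (closure U) := hUb.isCompact_closure
  have hτ := hW.isStoppingTime_clockInv hD hf hU hUD hx₀ u
  have hκ := hW.isStoppingTime_clockInv hD hf hU hUD hx₀ v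
  have hle : clockInv x₀ W f U u ≤ clockInv x₀ W f U v := clockInv_mono' huv
  have hfin : ∀ᵐ ω ∂P, clockInv x₀ W f U v ω ≠ ⊤ := by
    filter_upwards [hW.ae_hitTime_ne_top hU hUb hx₀] with ω hρ
    exact ne_top_of_le_ne_top hρ (clockInv_le_hitTime v ω)
  have hcontE : ∀ ω, Continuous fun t ↦ confExp θ x₀ W f U t ω := hW.continuous_confExp hD hf hU hUD hx₀ θ
  have hbd := hW.ae_norm_stoppedProcess_confExp_le hD hf hU hUb hUD hx₀ θ huv
  -- real and imaginary parts
  have hres : ∀ {L : ℂ → ℝ}, (L = Complex.re ∨ L = Complex.im) →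
      ∫ ω, G ω * (L (stoppedValue (confExp θ x₀ W f U) (clockInv x₀ W f U v) ω) : ℂ) ∂P =
        ∫ ω, G ω * (L (stoppedValue (confExp θ x₀ W f U) (clockInv x₀ W f U u) ω) : ℂ) ∂P := by
    intro L hL
    have hLc : Continuous L := by rcases hL with rfl | rfl <;> fun_prop
    have hLn : ∀ z, |L z| ≤ ‖z‖ := fun z ↦ by
      rcases hL with rfl | rfl
      · exact Complex.abs_re_le_norm z
      · exact Complex.abs_im_le_norm z
    have hM := hW.martingale_reIm_confExp hD hf hU hUc hUD hx₀ θ hL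
    have hcont : ∀ᵐ ω ∂P, Continuous fun t ↦ L (confExp θ x₀ W f U t ω) :=
      ae_of_all _ fun ω ↦ hLc.comp (hcontE ω)
    have hB : ∀ᵐ ω ∂P, ∀ n : ℕ,
        |stoppedProcess (fun t ω ↦ L (confExp θ x₀ W f U t ω)) (clockInv x₀ W f U v) n ω| ≤ Real.exp (‖θ‖ ^ 2 * v / 2) ∧
        |stoppedProcess (fun t ω ↦ L (confExp θ x₀ W f U t ω)) (clockInv x₀ W f U u) n ω| ≤ Real.exp (‖θ‖ ^ 2 * v / 2) := by
      filter_upwards [hbd] with ω hω n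
      exact ⟨(hLn _).trans (hω n).1, (hLn _).trans (hω n).2⟩
    have h := integral_mul_stoppedValue_eq_of_le hM hcont hτ hκ hle hfin hB hG hGC
    exact h
  -- recombine `E = Re E + i Im E`
  have hdecomp : ∀ (σ : Ω → WithTop ℝ≥0) (ω : Ω), G ω * stoppedValue (confExp θ x₀ W f U) σ ω =
      G ω * ((stoppedValue (confExp θ x₀ W f U) σ ω).re : ℂ) +
        G ω * ((stoppedValue (confExp θ x₀ W f U) σ ω).im : ℂ) * I := by
    intro σ ω
    conv_lhs => rw [← Complex.re_add_im (stoppedValue (confExp θ x₀ W f U) σ ω)]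
    ring
  -- integrability of the four pieces
  have hGm : AEStronglyMeasurable G P := hG.mono hτ.measurableSpace_le
  have hint : ∀ {σ : Ω → WithTop ℝ≥0}, IsStoppingTime hW.natFiltration σ → (∀ᵐ ω ∂P, σ ω ≠ ⊤) →
      (∀ᵐ ω ∂P, ∀ n : ℕ, ‖stoppedProcess (confExp θ x₀ W f U) σ n ω‖ ≤ Real.exp (‖θ‖ ^ 2 * v / 2)) →
      ∀ {L : ℂ → ℝ}, (L = Complex.re ∨ L = Complex.im) →
      Integrable (fun ω ↦ G ω * (L (stoppedValue (confExp θ x₀ W f U) σ ω) : ℂ)) P := by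
    intro σ hσ hfinσ hBσ L hL
    have hLc : Continuous L := by rcases hL with rfl | rfl <;> fun_prop
    have hLn : ∀ z, |L z| ≤ ‖z‖ := fun z ↦ by
      rcases hL with rfl | rfl
      · exact Complex.abs_re_le_norm z
      · exact Complex.abs_im_le_norm z
    have hM := hW.martingale_reIm_confExp hD hf hU hUc hUD hx₀ θ hL
    have hcont : ∀ᵐ ω ∂P, Continuous fun t ↦ L (confExp θ x₀ W f U t ω) :=
      ae_of_all _ fun ω ↦ hLc.comp (hcontE ω)
    have hsm : AEStronglyMeasurable (stoppedValue (fun t ω ↦ L (confExp θ x₀ W f U t ω)) σ) P :=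
      aestronglyMeasurable_stoppedValue_of_ae hM hcont hσ hfinσ
    have hsb : ∀ᵐ ω ∂P, ‖stoppedValue (fun t ω ↦ L (confExp θ x₀ W f U t ω)) σ ω‖ ≤ Real.exp (‖θ‖ ^ 2 * v / 2) := by
      filter_upwards [hfinσ, hBσ] with ω hω hb
      have ht := (tendsto_stoppedProcess_natCast (fun t ω ↦ L (confExp θ x₀ W f U t ω)) hω).norm
      exact le_of_tendsto' ht fun n ↦ (hLn _).trans (hb n)
    have hi : Integrable (stoppedValue (fun t ω ↦ L (confExp θ x₀ W f U t ω)) σ) P :=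
      ⟨hsm, HasFiniteIntegral.of_bounded hsb⟩
    exact (hi.ofReal (𝕜 := ℂ)).bdd_mul hGm hGC
  have hfinu : ∀ᵐ ω ∂P, clockInv x₀ W f U u ω ≠ ⊤ := by
    filter_upwards [hfin] with ω hω
    exact ne_top_of_le_ne_top hω (hle ω)
  have hBv : ∀ᵐ ω ∂P, ∀ n : ℕ, ‖stoppedProcess (confExp θ x₀ W f U) (clockInv x₀ W f U v) n ω‖ ≤ Real.exp (‖θ‖ ^ 2 * v / 2) :=
    hbd.mono fun ω hω n ↦ (hω n).1
  have hBu : ∀ᵐ ω ∂P, ∀ n : ℕ, ‖stoppedProcess (confExp θ x₀ W f U) (clockInv x₀ W f U u) n ω‖ ≤ Real.exp (‖θ‖ ^ 2 * v / 2) :=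
    hbd.mono fun ω hω n ↦ (hω n).2
  have i1 := hint hκ hfin hBv (L := Complex.re) (Or.inl rfl)
  have i2 := hint hκ hfin hBv (L := Complex.im) (Or.inr rfl)
  have i3 := hint hτ hfinu hBu (L := Complex.re) (Or.inl rfl)
  have i4 := hint hτ hfinu hBu (L := Complex.im) (Or.inr rfl)
  have e1 := hres (L := Complex.re) (Or.inl rfl)
  have e2 := hres (L := Complex.im) (Or.inr rfl)
  simp_rw [hdecomp]
  rw [integral_add i1 (i2.mul_const _), integral_add i3 (i4.mul_const _), integral_mul_const,
    integral_mul_const]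
  rw [e1, e2]

end Sampling

end IsBrownianVec

end Literature.Probability.Process

end
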